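import Literature.MathematicalPhysics.QuantumLattice.LiebWuBetheAnsatz
import Literature.MathematicalPhysics.QuantumLattice.LiebWuGoldbaumExistence
import Literature.MathematicalPhysics.QuantumLattice.HubbardRingPerronFrobeniusProofs
import HarnessLib

/-!
# The Lieb–Wu solution of the half-filled Hubbard chain: proofs (assembly below node F2)

Family `hubbard` (trunk T-QLATTICE), statement hubbard.S10. Sibling proof file of
`Literature/MathematicalPhysics/QuantumLattice/LiebWuBetheAnsatz.lean` (the decomposition of the
named fact `Literature.MathematicalPhysics.QuantumLattice.lieb_wu` into the nodes F1–F5b and F2c). It PROVES: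

* `liebWu_groundEnergyAt_eq_betheEnergy'_of_szSector` — **F2c → F2′**: the sector form of the
  ground-state identification (Goldbaum 2005 §4, in the sector `M = M' = 2m + 1`, rings of
  `4m + 2 ≥ 6` sites) implies the form over all `S^z` used by `lieb_wu_of_roots`, by the `SU(2)`
  reduction
  `groundEnergyAt_eq_minEnergyOn_szSector` (`HubbardRingPerronFrobeniusProofs`): every spin
  multiplet has an `S^z = 0` member, so the `N`-particle ground-state energy is attained in the
  joint sector `(N, S^z = 0)`.
* `lieb_wu_of_goldbaum` — `lieb_wu` from the named facts F1, F2c, F3, F5b; and, F1 being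
  discharged (`goldbaum_liebWuGroundRoots_exists_holds`, `LiebWuGoldbaumExistence`),
  `lieb_wu_of_goldbaum'` — **`lieb_wu` from the three remaining named facts F2c, F3, F5b**.
* `liebWu_isGroundStateInSector_halfFilled` — **Lieb–Wu 2003 §2 items 1.–2.** in the sector of
  F2c: on the ring of `4m + 2` sites with `t = 1`, for every real `U`, the ground state of the
  sector `(N, S^z) = (4m + 2, 0)` exists, is unique up to scalars, and has configuration amplitudes
  of one sign (specialisation of `liebWu_isGroundStateInSector_ring`, the Perron–Frobenius
  ingredient of the printed proof of F2c).
* `IsLiebWuRoots.exp_eq_prod`, `IsLiebWuRoots.prod_eq_prod` — the **exponential form of the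
  Lieb–Wu equations** (Essler–Frahm–Göhmann–Klümper–Korepin (2005), eqs. (3.95)–(3.96), with
  `u = U/4`) from the logarithmic form `IsLiebWuRoots` (Lieb–Wu 1968, eqs. (9)–(11)) under the
  printed parity rules for the quantum numbers (`I_j ∈ ℤ + M/2`, `J_α ∈ ℤ + (N - M + 1)/2`), and
  their specialisations `IsLiebWuGroundRoots.exp_eq_prod`, `IsLiebWuGroundRoots.prod_eq_prod` to
  the ground-state quantum numbers `liebWuGroundNumbers` at half filling. This checks the sign and
  normalisation conventions of `liebWuTheta`/`IsLiebWuRoots` against the Bethe-ansatz literature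
  (the form in which the Bethe-ansatz eigenvector theorem, Essler et al. (3.91)–(3.97), produces
  the equations) — the interface for the remaining ingredient of F2c.
* `not_liebWu_groundEnergyAt_eq_betheEnergy` — **the node F2 as first vendored (all `m`) is
  FALSE**: at `m = 0` (`N_a = 2`) the Lieb–Wu equations describe the doubly-bonded two-site ring
  (Bethe energy `(U - √(U² + 64))/2`, `betheEnergy_of_isLiebWuGroundRoots_zero`), while
  `hubbardChain 2` has a single bond and `E₀ ≥ -2` by the general degree bound
  `neg_degree_mul_le_groundEnergyAt` (`E₀(N) ≥ -|t| d N` on graphs of maximal degree `d`,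
  `U ≥ 0`). Hence the replacement F2′ (`m ≥ 1`) in `LiebWuBetheAnsatz`.

No statement of `LiebWuBetheAnsatz` or `HubbardHubbardModel` is restated or changed.

## References

* P. S. Goldbaum, CMP 258 (2005) 317 = arXiv:cond-mat/0403736, §4. [Goldbaum2005]
* E. H. Lieb, F. Y. Wu, Physica A 321 (2003) 1 = arXiv:cond-mat/0207529, §2 items 1.–2., §3,
  §5 ("so we are allowed to take `S^z = 0`"). [LiebWuPhysicaA2003]
* E. H. Lieb, F. Y. Wu, PRL 20 (1968) 1445 (reprinted in A. Montorsi (ed.), *The Hubbard Model*,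
  World Scientific 1992, pp. 63–68), eqs. (9)–(11) and the parity rules following (11).
  [LiebWuPRL1968]
* F. H. L. Essler, H. Frahm, F. Göhmann, A. Klümper, V. E. Korepin, *The One-Dimensional Hubbard
  Model*, CUP 2005, §3.3.2, eqs. (3.95)–(3.97) (held; PDF pp. 94–95). [EsslerEtAl2005]
-/

namespace Literature.MathematicalPhysics.QuantumLattice


/-- **F2c → F2′.** If, on every ring of `4m + 2 ≥ 6` sites (`t = 1`, `U > 0`), the lowest energy of
the sector `(N, S^z) = (4m + 2, 0)` is the Bethe energy of some ground-state roots, then so is the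
ground-state energy at half filling over all `S^z`: the two energies coincide by
`groundEnergyAt_eq_minEnergyOn_szSector` (`2m + 1 ≤ 4m + 2 = |Λ|`). Lieb–Wu, Physica A 321
(2003) 1, §5 ("the ground state has `S = 0` ... so we are allowed to take `S^z = 0`"); Goldbaum,
CMP 258 (2005) 317, §4. [cite: Goldbaum2005, §4] [cite: LiebWuPhysicaA2003, §5] -/
theorem liebWu_groundEnergyAt_eq_betheEnergy'_of_szSector
    (h : liebWu_minEnergyOn_szSector_eq_betheEnergy) : liebWu_groundEnergyAt_eq_betheEnergy' := by
  intro U hU m hm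
  obtain ⟨k, Λ, hk, hE⟩ := h U hU m hm
  refine ⟨k, Λ, hk, ?_⟩
  have hcard : 2 * m + 1 ≤ Fintype.card (FermionTorus 1 (4 * m + 2)) := by
    rw [card_fermionTorus_one]
    omega
  have h2 := groundEnergyAt_eq_minEnergyOn_szSector (hubbardChain (4 * m + 2)) 1 U hcard
  rw [show 2 * (2 * m + 1) = 4 * m + 2 by ring] at h2
  rw [h2, hE]

/-- **`lieb_wu` from F1, F2c, F3 and F5b** (F4, F5a and the reduction F2c → F2′ being proved):
ground-state roots exist on every ring of `4m + 2` sites (F1, Goldbaum 2005 Thm 1.1), the Bethe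
state is the ground state of its sector on the rings of `4m + 2 ≥ 6` sites (F2c, Goldbaum 2005
§4), the Bethe energies per site converge to `liebWuEnergy U` (F3, Goldbaum 2005 §5 / Lieb–Wu
2003 §6), and `E(2n) - E(2n-1) → μ₋(U)` (F5b, Lieb–Wu 1968 eq. (23) / 2003 §7).
[cite: LiebWuPRL1968, eqs. (20)–(23)] [cite: Goldbaum2005, Thm 1.1, §§4–5] [cite: LiebWuPhysicaA2003, §§6–7] -/
theorem lieb_wu_of_goldbaum (h₁ : goldbaum_liebWuGroundRoots_exists)
    (h₂ : liebWu_minEnergyOn_szSector_eq_betheEnergy) (h₃ : liebWu_betheEnergy_tendsto)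
    (h₆ : liebWu_muMinus_tendsto) : lieb_wu :=
  lieb_wu_of_roots' h₁ (liebWu_groundEnergyAt_eq_betheEnergy'_of_szSector h₂) h₃ h₆

/-- **`lieb_wu` from F2c, F3 and F5b** — the remaining named facts after the discharge of F1
(Goldbaum's existence theorem, `goldbaum_liebWuGroundRoots_exists_holds`), F4, F5a and the
reduction F2c → F2′: the Bethe state is the ground state of its sector on the rings of
`4m + 2 ≥ 6` sites (F2c, Goldbaum 2005 §4), the Bethe energies per site converge to
`liebWuEnergy U` (F3, Goldbaum 2005 §5 / Lieb–Wu 2003 §6), and `E(2n) - E(2n-1) → μ₋(U)` (F5b,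
Lieb–Wu 1968 eq. (23) / 2003 §7).
[cite: LiebWuPRL1968, eqs. (20)–(23)] [cite: Goldbaum2005, §§4–5] [cite: LiebWuPhysicaA2003, §§6–7] -/
theorem lieb_wu_of_goldbaum' (h₂ : liebWu_minEnergyOn_szSector_eq_betheEnergy)
    (h₃ : liebWu_betheEnergy_tendsto) (h₆ : liebWu_muMinus_tendsto) : lieb_wu :=
  lieb_wu_of_goldbaum goldbaum_liebWuGroundRoots_exists_holds h₂ h₃ h₆

/-- **Lieb–Wu 2003, §2, items 1.–2. in the sector of F2c.** On the Hubbard ring of `4m + 2` sites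
with `t = 1` and ANY real `U`, in the joint sector `(N, S^z) = (4m + 2, 0)` (`M = M' = 2m + 1`
odd): a ground state exists; any two ground states are proportional ("there is only one ground
state"); and a ground state has, up to a nonzero constant, all configuration amplitudes
`σ(α,β) ψ(α↑ ∪ β↓)` (Lieb's `W_{αβ} = liebW (2m+1) ψ α β`, Lieb–Wu's `f(X)` on the region `R`)
real and strictly positive. Lieb–Wu, Physica A 321 (2003) 1 = arXiv:cond-mat/0207529, §2,
items 1.–2. (with `N_a = 2 × odd`, `M = M' = N_a/2`, p. 4). [cite: LiebWuPhysicaA2003, §2, items 1–2] -/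
theorem liebWu_isGroundStateInSector_halfFilled (U : ℝ) (m : ℕ) :
    (∃ ψ, IsGroundStateInSector (hamiltonian (hubbardChain (4 * m + 2)) 1 U) (4 * m + 2) 0 ψ) ∧
      (∀ ψ₁ ψ₂, IsGroundStateInSector (hamiltonian (hubbardChain (4 * m + 2)) 1 U) (4 * m + 2) 0 ψ₁ →
          IsGroundStateInSector (hamiltonian (hubbardChain (4 * m + 2)) 1 U) (4 * m + 2) 0 ψ₂ →
          ∃ c : ℂ, ψ₂ = c • ψ₁) ∧
        ∀ ψ, IsGroundStateInSector (hamiltonian (hubbardChain (4 * m + 2)) 1 U) (4 * m + 2) 0 ψ →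
          ∃ c : ℂ, c ≠ 0 ∧ ∀ α β : Config (FermionTorus 1 (4 * m + 2)) (2 * m + 1),
            0 < (c * liebW (2 * m + 1) ψ α β).re ∧ (c * liebW (2 * m + 1) ψ α β).im = 0 := by
  have h := liebWu_isGroundStateInSector_ring (4 * m + 2) one_pos U (n := 2 * m + 1) ⟨m, rfl⟩
    (by omega)
  rwa [show 2 * (2 * m + 1) = 4 * m + 2 by ring] at h


/-! ### The exponential form of the Lieb–Wu equations (Essler et al. (3.95)–(3.96)) -/

section ExpForm

open Finset Complex
open scoped Real

/-- `e^{-2i arctan x} = (1 - ix)/(1 + ix)` (`x` real): with `φ = arctan x`,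
`1 ± i tan φ = e^{±iφ}/cos φ`. [folklore] -/
theorem exp_neg_two_arctan_mul_I (x : ℝ) :
    Complex.exp (-(2 * (Real.arctan x : ℂ)) * I) = (1 - x * I) / (1 + x * I) := by
  set φ : ℝ := Real.arctan x with hφ
  have hc : Real.cos φ ≠ 0 := (Real.cos_arctan_pos x).ne'
  have hc' : (Real.cos φ : ℂ) ≠ 0 := Complex.ofReal_ne_zero.2 hc
  have hx : (x : ℂ) = (Real.sin φ : ℂ) / (Real.cos φ : ℂ) := by
    rw [← Complex.ofReal_div, ← Real.tan_eq_sin_div_cos, hφ, Real.tan_arctan]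
  have hden : (1 + (x : ℂ) * I) ≠ 0 := by
    intro h
    have := congrArg Complex.re h
    simp at this
  rw [eq_div_iff hden]
  have hexp : Complex.exp (-(2 * (φ : ℂ)) * I) =
      ((Real.cos φ : ℂ) - (Real.sin φ : ℂ) * I) * ((Real.cos φ : ℂ) - (Real.sin φ : ℂ) * I) := by
    rw [show (-(2 * (φ : ℂ)) * I) = ((-φ : ℝ) : ℂ) * I + ((-φ : ℝ) : ℂ) * I by push_cast; ring,
      Complex.exp_add, Complex.exp_mul_I, ← Complex.ofReal_cos, ← Complex.ofReal_sin,
      Real.cos_neg, Real.sin_neg]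
    push_cast
    ring
  have hpy : (Real.cos φ : ℂ) ^ 2 + (Real.sin φ : ℂ) ^ 2 = 1 := by
    rw [← Complex.ofReal_pow, ← Complex.ofReal_pow, ← Complex.ofReal_add, Real.cos_sq_add_sin_sq]
    simp
  rw [hexp, hx]
  field_simp
  linear_combination ((Real.cos φ : ℂ) - (Real.sin φ : ℂ) * I) * hpy +
    ((Real.sin φ : ℂ) ^ 3 * I - (Real.cos φ : ℂ) * (Real.sin φ : ℂ) ^ 2) * Complex.I_sq

/-- The Lieb–Wu phase factor: `e^{iθ(2 sin k - 2Λ)} = -(Λ - sin k - iu)/(Λ - sin k + iu)` with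
`u = U/4` (`θ(p) = -2 arctan(2p/U)`, `U ≠ 0`): the factor of Essler et al. (3.95) up to the sign
absorbed by the parity rule for `I_j`. Essler et al. (2005), (3.95); Lieb–Wu, PRL 20 (1968) 1445,
eqs. (9), (11). [cite: EsslerEtAl2005, eq. (3.95)] -/
theorem exp_liebWuTheta_mul_I {U : ℝ} (hU : U ≠ 0) (s Λ : ℝ) :
    Complex.exp ((liebWuTheta U (2 * s - 2 * Λ) : ℂ) * I) =
      -(((Λ : ℂ) - s - (U / 4 : ℝ) * I) / ((Λ : ℂ) - s + (U / 4 : ℝ) * I)) := by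
  rw [liebWuTheta, show 2 * (2 * s - 2 * Λ) / U = 4 * (s - Λ) / U by ring]
  have h1 : ((-2 * Real.arctan (4 * (s - Λ) / U) : ℝ) : ℂ) * I =
      -(2 * (Real.arctan (4 * (s - Λ) / U) : ℂ)) * I := by
    push_cast
    ring
  rw [h1, exp_neg_two_arctan_mul_I]
  have hden1 : (1 + ((4 * (s - Λ) / U : ℝ) : ℂ) * I) ≠ 0 := by
    intro h
    have := congrArg Complex.re h
    simp at this
  have hden2 : ((Λ : ℂ) - s + (U / 4 : ℝ) * I) ≠ 0 := by
    intro h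
    have := congrArg Complex.im h
    simp at this
    exact hU this
  rw [← neg_div, div_eq_div_iff hden1 hden2]
  have hU' : (U : ℂ) ≠ 0 := Complex.ofReal_ne_zero.2 hU
  push_cast
  field_simp
  linear_combination (8 * (U : ℂ) * ((Λ : ℂ) - s)) * Complex.I_sq

/-- The spin phase factor: `e^{-iθ(b)} = (U/2 + ib)/(U/2 - ib)` (`U ≠ 0`), the factor of Essler et
al. (3.96) (right side, `λ_ℓ - λ_m ∓ 2iu`, `2u = U/2`) up to sign. Essler et al. (2005), (3.96);
Lieb–Wu, PRL 20 (1968) 1445, eqs. (10), (11). [cite: EsslerEtAl2005, eq. (3.96)] -/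
theorem exp_neg_liebWuTheta_mul_I {U : ℝ} (hU : U ≠ 0) (b : ℝ) :
    Complex.exp (-(liebWuTheta U b : ℂ) * I) =
      (((U / 2 : ℝ) : ℂ) + b * I) / (((U / 2 : ℝ) : ℂ) - b * I) := by
  rw [liebWuTheta]
  have h1 : -((-2 * Real.arctan (2 * b / U) : ℝ) : ℂ) * I =
      -(-(2 * (Real.arctan (2 * b / U) : ℂ)) * I) := by
    push_cast
    ring
  rw [h1, Complex.exp_neg, exp_neg_two_arctan_mul_I, inv_div]
  have hden1 : (1 - ((2 * b / U : ℝ) : ℂ) * I) ≠ 0 := by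
    intro h
    have := congrArg Complex.re h
    simp at this
  have hden2 : (((U / 2 : ℝ) : ℂ) - b * I) ≠ 0 := by
    intro h
    have := congrArg Complex.re h
    simp at this
    exact hU this
  rw [div_eq_div_iff hden1 hden2]
  have hU' : (U : ℂ) ≠ 0 := Complex.ofReal_ne_zero.2 hU
  push_cast
  field_simp

/-- `e^{2πiI} = (-1)^p` for a quantum number `I ∈ ℤ + p/2` (integer or half-odd integer according
to the parity of `p`). Lieb–Wu, PRL 20 (1968) 1445, parity rules following eq. (11). [folklore] -/
theorem exp_two_pi_mul_I_of_half {r : ℝ} {z : ℤ} {p : ℕ} (hr : r = z + (p : ℝ) / 2) :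
    Complex.exp (2 * π * (r : ℂ) * I) = (-1) ^ p := by
  rw [hr]
  push_cast
  rw [show 2 * (π : ℂ) * ((z : ℂ) + (p : ℂ) / 2) * I = (z : ℂ) * (2 * π * I) + (p : ℂ) * (π * I) by ring,
    Complex.exp_add, Complex.exp_int_mul_two_pi_mul_I, one_mul, Complex.exp_nat_mul,
    Complex.exp_pi_mul_I]

variable {U : ℝ} {Na N M : ℕ} {Iq : Fin N → ℝ} {Jq : Fin M → ℝ} {k : Fin N → ℝ} {Λ : Fin M → ℝ}

/-- **The first Lieb–Wu equation in exponential form** (Essler et al. (3.95),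
`e^{i k_j L} = ∏_ℓ (λ_ℓ - sin k_j - iu)/(λ_ℓ - sin k_j + iu)`, `u = U/4`, `L = N_a`): it follows
from the logarithmic form `N_a k_j = 2π I_j + Σ_β θ(2 sin k_j - 2Λ_β)` (`IsLiebWuRoots`) when
`U ≠ 0` and the `I_j` obey Lieb–Wu's parity rule "`I_j` = integers (or half-odd integers) for `M` =
even (or odd)", i.e. `I_j ∈ ℤ + M/2`. Lieb–Wu, PRL 20 (1968) 1445, eqs. (9), (11) and the parity
rules; Essler et al. (2005), eq. (3.95). [cite: EsslerEtAl2005, eq. (3.95)]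
[cite: LiebWuPRL1968, eqs. (9)–(11)] -/
theorem IsLiebWuRoots.exp_eq_prod (hU : U ≠ 0) (h : IsLiebWuRoots U Na Iq Jq k Λ)
    (hI : ∀ j, ∃ z : ℤ, Iq j = z + (M : ℝ) / 2) (j : Fin N) :
    Complex.exp ((Na : ℂ) * (k j : ℂ) * I) =
      ∏ β, ((Λ β : ℂ) - Real.sin (k j) - ((U / 4 : ℝ) : ℂ) * I) /
        ((Λ β : ℂ) - Real.sin (k j) + ((U / 4 : ℝ) : ℂ) * I) := by
  have e := h.1 j
  have e' : (Na : ℂ) * (k j : ℂ) * I =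
      2 * π * (Iq j : ℂ) * I + ∑ β, (liebWuTheta U (2 * Real.sin (k j) - 2 * Λ β) : ℂ) * I := by
    rw [← Finset.sum_mul, ← add_mul]
    congr 1
    exact_mod_cast e
  obtain ⟨z, hz⟩ := hI j
  rw [e', Complex.exp_add, Complex.exp_sum, exp_two_pi_mul_I_of_half hz]
  simp only [exp_liebWuTheta_mul_I hU]
  rw [Finset.prod_neg, Finset.card_univ, Fintype.card_fin, ← mul_assoc, ← pow_add, ← two_mul,
    pow_mul, neg_one_sq, one_pow, one_mul]

/-- **The second Lieb–Wu equation in exponential form** (Essler et al. (3.96),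
`∏_j (λ_ℓ - sin k_j - iu)/(λ_ℓ - sin k_j + iu) = ∏_{m ≠ ℓ} (λ_ℓ - λ_m - 2iu)/(λ_ℓ - λ_m + 2iu)`,
`u = U/4`): it follows from the logarithmic form
`Σ_j θ(2 sin k_j - 2Λ_α) = 2π J_α - Σ_β θ(Λ_α - Λ_β)` (`IsLiebWuRoots`) when `U ≠ 0` and the
`J_α` obey Lieb–Wu's parity rule "`J_α` = integers (or half-odd integers) for `M' = N - M` = odd
(or even)", i.e. `J_α ∈ ℤ + (N + M + 1)/2`. Lieb–Wu, PRL 20 (1968) 1445, eqs. (10), (11) and the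
parity rules; Essler et al. (2005), eq. (3.96). [cite: EsslerEtAl2005, eq. (3.96)]
[cite: LiebWuPRL1968, eqs. (9)–(11)] -/
theorem IsLiebWuRoots.prod_eq_prod (hU : U ≠ 0) (h : IsLiebWuRoots U Na Iq Jq k Λ)
    (hJ : ∀ α, ∃ z : ℤ, Jq α = z + ((N + M + 1 : ℕ) : ℝ) / 2) (α : Fin M) :
    ∏ j, ((Λ α : ℂ) - Real.sin (k j) - ((U / 4 : ℝ) : ℂ) * I) /
        ((Λ α : ℂ) - Real.sin (k j) + ((U / 4 : ℝ) : ℂ) * I) =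
      ∏ β ∈ univ.erase α, ((Λ α : ℂ) - Λ β - ((U / 2 : ℝ) : ℂ) * I) /
        ((Λ α : ℂ) - Λ β + ((U / 2 : ℝ) : ℂ) * I) := by
  have e := h.2 α
  -- exponentiate both sides of the second Lieb–Wu equation
  have eL : Complex.exp ((∑ j, liebWuTheta U (2 * Real.sin (k j) - 2 * Λ α) : ℝ) * I) =
      (-1) ^ N * ∏ j, ((Λ α : ℂ) - Real.sin (k j) - ((U / 4 : ℝ) : ℂ) * I) /
        ((Λ α : ℂ) - Real.sin (k j) + ((U / 4 : ℝ) : ℂ) * I) := by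
    rw [Complex.ofReal_sum, Finset.sum_mul, Complex.exp_sum]
    simp only [exp_liebWuTheta_mul_I hU]
    rw [Finset.prod_neg, Finset.card_univ, Fintype.card_fin]
  set G : Fin M → ℂ := fun β => ((Λ α : ℂ) - Λ β - ((U / 2 : ℝ) : ℂ) * I) /
    ((Λ α : ℂ) - Λ β + ((U / 2 : ℝ) : ℂ) * I) with hG
  have hGneg : ∀ β, Complex.exp (-((liebWuTheta U (Λ α - Λ β) : ℂ) * I)) = -G β := by
    intro β
    rw [← neg_mul, exp_neg_liebWuTheta_mul_I hU, hG]
    have hden1 : (((U / 2 : ℝ) : ℂ) - (Λ α - Λ β : ℝ) * I) ≠ 0 := by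
      intro h0
      have := congrArg Complex.re h0
      simp at this
      exact hU this
    have hden2 : ((Λ α : ℂ) - Λ β + ((U / 2 : ℝ) : ℂ) * I) ≠ 0 := by
      intro h0
      have := congrArg Complex.im h0
      simp at this
      exact hU this
    dsimp only
    rw [← neg_div, div_eq_div_iff hden1 hden2]
    push_cast
    linear_combination ((U : ℂ) * ((Λ α : ℂ) - Λ β)) * Complex.I_sq
  have hGα : G α = -1 := by
    rw [hG]
    dsimp only
    have hc : (((U / 2 : ℝ) : ℂ) * I) ≠ 0 := by
      refine mul_ne_zero ?_ Complex.I_ne_zero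
      exact_mod_cast (div_ne_zero hU two_ne_zero)
    rw [sub_self, zero_sub, zero_add, neg_div, div_self hc]
  obtain ⟨z, hz⟩ := hJ α
  have hsign : ((-1 : ℂ) ^ (M + 1)) * ((-1) ^ M * -1) = 1 := by
    rw [← pow_succ, ← pow_add, ← two_mul, pow_mul, neg_one_sq, one_pow]
  have eR : Complex.exp (((2 * π * Jq α - ∑ β, liebWuTheta U (Λ α - Λ β) : ℝ) : ℂ) * I) =
      (-1) ^ N * ∏ β ∈ univ.erase α, G β := by
    push_cast
    rw [sub_mul, Finset.sum_mul, sub_eq_add_neg, ← Finset.sum_neg_distrib, Complex.exp_add,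
      Complex.exp_sum, exp_two_pi_mul_I_of_half hz]
    simp only [hGneg]
    rw [Finset.prod_neg, Finset.card_univ, Fintype.card_fin,
      ← Finset.mul_prod_erase univ G (mem_univ α), hGα, show N + M + 1 = N + (M + 1) by ring,
      pow_add, mul_assoc]
    congr 1
    generalize ∏ x ∈ univ.erase α, G x = P
    linear_combination P * hsign
  have key : Complex.exp (((∑ j, liebWuTheta U (2 * Real.sin (k j) - 2 * Λ α) : ℝ) : ℂ) * I) =
      Complex.exp (((2 * π * Jq α - ∑ β, liebWuTheta U (Λ α - Λ β) : ℝ) : ℂ) * I) := by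
    rw [e]
  rw [eL, eR] at key
  exact mul_left_cancel₀ (pow_ne_zero N (neg_ne_zero.2 one_ne_zero)) key

/-- The ground-state quantum numbers `I_j = j - (N+1)/2`, `N = 4m + 2`, are half-odd integers,
as required for `M = 2m + 1` odd: `I_j ∈ ℤ + M/2`. Lieb–Wu, PRL 20 (1968) 1445 (parity rules);
Physica A 321 (2003) 1, §3. [cite: LiebWuPhysicaA2003, §3] -/
theorem liebWuGroundNumbers_mem_half (m : ℕ) (i : Fin (4 * m + 2)) :
    ∃ z : ℤ, liebWuGroundNumbers (4 * m + 2) i = z + ((2 * m + 1 : ℕ) : ℝ) / 2 := by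
  refine ⟨(i : ℤ) - 3 * m - 1, ?_⟩
  simp only [liebWuGroundNumbers]
  push_cast
  ring

/-- The ground-state quantum numbers `J_α = α - (M+1)/2`, `M = 2m + 1`, are integers, as required
for `M' = N - M = 2m + 1` odd: `J_α ∈ ℤ + (N + M + 1)/2` with `N = 4m + 2`. Lieb–Wu, PRL 20 (1968)
1445 (parity rules); Physica A 321 (2003) 1, §3. [cite: LiebWuPhysicaA2003, §3] -/
theorem liebWuGroundNumbers_mem_int (m : ℕ) (a : Fin (2 * m + 1)) :
    ∃ z : ℤ, liebWuGroundNumbers (2 * m + 1) a =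
      z + ((4 * m + 2 + (2 * m + 1) + 1 : ℕ) : ℝ) / 2 := by
  refine ⟨(a : ℤ) - 4 * m - 2, ?_⟩
  simp only [liebWuGroundNumbers]
  push_cast
  ring

/-- **Exponential Lieb–Wu equations for the half-filled ground-state roots, charge part**
(Essler et al. (3.95) with `L = N = 4m + 2`, `M = 2m + 1`, `u = U/4`), from
`IsLiebWuGroundRoots` (`U ≠ 0`). [cite: EsslerEtAl2005, eq. (3.95)] -/
theorem IsLiebWuGroundRoots.exp_eq_prod {m : ℕ} {k : Fin (4 * m + 2) → ℝ}
    {Λ : Fin (2 * m + 1) → ℝ} (hU : U ≠ 0) (h : IsLiebWuGroundRoots U m k Λ) (j : Fin (4 * m + 2)) :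
    Complex.exp (((4 * m + 2 : ℕ) : ℂ) * (k j : ℂ) * I) =
      ∏ β, ((Λ β : ℂ) - Real.sin (k j) - ((U / 4 : ℝ) : ℂ) * I) /
        ((Λ β : ℂ) - Real.sin (k j) + ((U / 4 : ℝ) : ℂ) * I) :=
  h.1.exp_eq_prod hU (fun i => liebWuGroundNumbers_mem_half m i) j

/-- **Exponential Lieb–Wu equations for the half-filled ground-state roots, spin part**
(Essler et al. (3.96) with `N = 4m + 2`, `M = 2m + 1`, `u = U/4`), from `IsLiebWuGroundRoots`
(`U ≠ 0`). [cite: EsslerEtAl2005, eq. (3.96)] -/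
theorem IsLiebWuGroundRoots.prod_eq_prod {m : ℕ} {k : Fin (4 * m + 2) → ℝ}
    {Λ : Fin (2 * m + 1) → ℝ} (hU : U ≠ 0) (h : IsLiebWuGroundRoots U m k Λ) (α : Fin (2 * m + 1)) :
    ∏ j, ((Λ α : ℂ) - Real.sin (k j) - ((U / 4 : ℝ) : ℂ) * I) /
        ((Λ α : ℂ) - Real.sin (k j) + ((U / 4 : ℝ) : ℂ) * I) =
      ∏ β ∈ univ.erase α, ((Λ α : ℂ) - Λ β - ((U / 2 : ℝ) : ℂ) * I) /
        ((Λ α : ℂ) - Λ β + ((U / 2 : ℝ) : ℂ) * I) :=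
  h.1.prod_eq_prod hU (fun a => liebWuGroundNumbers_mem_int m a) α

end ExpForm


/-! ### The node F2 (all `m`) is false: the ring of two sites -/

section TwoSites

open Matrix Finset ThermodynamicLimit
open scoped ComplexOrder Real

/-- Cauchy–Schwarz/AM–GM for hopping amplitudes:
`|Re ⟨c_a ψ, c_b ψ⟩| ≤ (⟨c_a ψ, c_a ψ⟩ + ⟨c_b ψ, c_b ψ⟩)/2`. Tasaki (2020) §2.1. [folklore] -/
theorem abs_re_dotProduct_annihilation_le {κ : Type*} [LinearOrder κ] [Fintype κ] (ψ : Fock κ)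
    (a b : κ) :
    |(star (annihilation a *ᵥ ψ) ⬝ᵥ (annihilation b *ᵥ ψ)).re| ≤
      ((star (annihilation a *ᵥ ψ) ⬝ᵥ (annihilation a *ᵥ ψ)).re +
        (star (annihilation b *ᵥ ψ) ⬝ᵥ (annihilation b *ᵥ ψ)).re) / 2 := by
  have key : ∀ u v : Fock κ, star u ⬝ᵥ v =
      @inner ℂ _ _ (WithLp.toLp 2 u : EuclideanSpace ℂ (Finset κ)) (WithLp.toLp 2 v) := by
    intro u v
    rw [EuclideanSpace.inner_toLp_toLp, dotProduct_comm]
  have hnorm : ∀ u : Fock κ, ‖(WithLp.toLp 2 u : EuclideanSpace ℂ (Finset κ))‖ ^ 2 =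
      (star u ⬝ᵥ u).re := by
    intro u
    rw [key, ← inner_self_eq_norm_sq (𝕜 := ℂ)]
    rfl
  set u := (WithLp.toLp 2 (annihilation a *ᵥ ψ) : EuclideanSpace ℂ (Finset κ)) with hu
  set v := (WithLp.toLp 2 (annihilation b *ᵥ ψ) : EuclideanSpace ℂ (Finset κ)) with hv
  rw [← hnorm, ← hnorm, key]
  have h1 : |(@inner ℂ _ _ u v).re| ≤ ‖u‖ * ‖v‖ :=
    (Complex.abs_re_le_norm _).trans (norm_inner_le_norm u v)
  nlinarith [two_mul_le_add_sq ‖u‖ ‖v‖]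


section Degree

variable {Λ : Type*} [LinearOrder Λ] [Fintype Λ] (G : SimpleGraph Λ) [DecidableRel G.Adj]

/-- `Σ_{x,σ} ⟨c_{xσ} ψ, c_{xσ} ψ⟩ = ⟨ψ, N ψ⟩ = N` on unit `N`-particle vectors. [folklore] -/
theorem sum_re_dotProduct_annihilation_self {N : ℕ} {ψ : Fock (Orb Λ)} (hψN : IsNParticle N ψ)
    (hψ1 : star ψ ⬝ᵥ ψ = 1) :
    ∑ x : Λ, ∑ σ : Fin 2, (star (annihilation (orb x σ) *ᵥ ψ) ⬝ᵥ (annihilation (orb x σ) *ᵥ ψ)).re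
      = N := by
  have h1 : ∀ x σ, star (annihilation (orb x σ) *ᵥ ψ) ⬝ᵥ (annihilation (orb x σ) *ᵥ ψ) =
      star ψ ⬝ᵥ (numberOp x σ *ᵥ ψ) := by
    intro x σ
    rw [← dotProduct_creation_mul_annihilation_mulVec]
    rfl
  simp only [h1]
  have h2 : ∑ x : Λ, ∑ σ : Fin 2, star ψ ⬝ᵥ (numberOp x σ *ᵥ ψ) = star ψ ⬝ᵥ (totalNumber *ᵥ ψ) := by
    simp only [totalNumber, Matrix.sum_mulVec, dotProduct_sum]
  have h3 : ∑ x : Λ, ∑ σ : Fin 2, star ψ ⬝ᵥ (numberOp x σ *ᵥ ψ) = (N : ℂ) := by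
    rw [h2, ← Literature.MathematicalPhysics.QuantumLattice.totalNumberOp_eq_totalNumber, Literature.MathematicalPhysics.QuantumLattice.totalNumberOp_eq_diagonal]
    simp only [dotProduct, mulVec_diagonal, Pi.star_apply]
    calc ∑ s, star (ψ s) * ((s.card : ℂ) * ψ s)
        = ∑ s, (N : ℂ) * (star (ψ s) * ψ s) := by
          refine Finset.sum_congr rfl fun s _ => ?_
          by_cases hs : s.card = N
          · rw [hs]
            ring
          · rw [hψN s hs]
            simp
      _ = (N : ℂ) * (star ψ ⬝ᵥ ψ) := by
          rw [← Finset.mul_sum]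
          rfl
      _ = N := by rw [hψ1, mul_one]
  have h4 := congrArg Complex.re h3
  simpa [Complex.re_sum] using h4

/-- **Degree bound for the kinetic energy.** On a graph all of whose vertices have at most `d`
neighbours, for `U ≥ 0` every sector satisfies `E₀(N) ≥ -|t| d N`: by Cauchy–Schwarz
`|Re ⟨c_{xσ}ψ, c_{yσ}ψ⟩| ≤ (⟨n_{xσ}⟩ + ⟨n_{yσ}⟩)/2`, and `Σ_{x,σ} ⟨n_{xσ}⟩ = N`. [folklore] -/
theorem neg_degree_mul_le_groundEnergyAt {d : ℕ} (hd : ∀ x : Λ, #{y | G.Adj x y} ≤ d) (t : ℝ)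
    {U : ℝ} (hU : 0 ≤ U) {N : ℕ} (hN : N ≤ 2 * Fintype.card Λ) :
    -(|t| * d * N) ≤ groundEnergyAt G t U N := by
  have hc : N ≤ Fintype.card (Orb Λ) := by rwa [card_orb]
  refine le_csInf (groundEnergySet_nonempty _ hc) ?_
  rintro E ⟨ψ, hψN, hψ1, rfl⟩
  unfold QuantumLattice.expect
  rw [dotProduct_hamiltonian_mulVec, Complex.add_re]
  -- densities
  set n : Λ → Fin 2 → ℝ := fun x σ =>
    (star (annihilation (orb x σ) *ᵥ ψ) ⬝ᵥ (annihilation (orb x σ) *ᵥ ψ)).re with hn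
  have hn0 : ∀ x σ, 0 ≤ n x σ := fun x σ => re_dotProduct_annihilation_self_nonneg ψ _
  have hsumn : ∑ x, ∑ σ, n x σ = N := sum_re_dotProduct_annihilation_self hψN hψ1
  -- degrees (in both orders of the pair)
  have hdeg1 : ∀ x, ∑ y, (if G.Adj x y then (1 : ℝ) else 0) ≤ d := by
    intro x
    rw [Finset.sum_boole]
    exact_mod_cast hd x
  have hdeg2 : ∀ y, ∑ x, (if G.Adj x y then (1 : ℝ) else 0) ≤ d := by
    intro y
    rw [Finset.sum_boole]
    have : (#{x | G.Adj x y} : ℕ) = #{x | G.Adj y x} := by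
      congr 1
      ext x
      simp [G.adj_comm]
    rw [this]
    exact_mod_cast hd y
  set A : ℂ := ∑ x, ∑ y, ∑ σ : Fin 2, if G.Adj x y then
      star (annihilation (orb x σ) *ᵥ ψ) ⬝ᵥ (annihilation (orb y σ) *ᵥ ψ) else 0 with hA
  set a : Λ → Λ → ℝ := fun x y => if G.Adj x y then 1 else 0 with ha
  set m : Λ → ℝ := fun x => ∑ σ : Fin 2, n x σ with hm
  have hm0 : ∀ x, 0 ≤ m x := fun x => Finset.sum_nonneg fun σ _ => hn0 x σ
  -- `|Re A| ≤ Σ_{x,y} a x y (m x + m y)/2 ≤ d N`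
  have hAre : |A.re| ≤ d * N := by
    have hterm : ∀ x y (σ : Fin 2), |(if G.Adj x y then
        star (annihilation (orb x σ) *ᵥ ψ) ⬝ᵥ (annihilation (orb y σ) *ᵥ ψ) else (0 : ℂ)).re| ≤
        a x y * ((n x σ + n y σ) / 2) := by
      intro x y σ
      rw [ha]
      dsimp only
      split_ifs with hxy
      · rw [one_mul]
        exact abs_re_dotProduct_annihilation_le ψ _ _
      · simp
    have e1 : ∀ x y, ∑ σ : Fin 2, a x y * ((n x σ + n y σ) / 2) =
        a x y * m x / 2 + a x y * m y / 2 := by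
      intro x y
      simp only [hm, Fin.sum_univ_two]
      ring
    have hT1 : ∑ x, ∑ y, a x y * m x / 2 ≤ d * N / 2 := by
      calc ∑ x, ∑ y, a x y * m x / 2 = (∑ x, (∑ y, a x y) * m x) / 2 := by
            rw [Finset.sum_div]
            refine Finset.sum_congr rfl fun x _ => ?_
            rw [Finset.sum_mul, Finset.sum_div]
        _ ≤ (∑ x, (d : ℝ) * m x) / 2 := by
            gcongr with x _
            · exact hm0 x
            · exact hdeg1 x
        _ = d * N / 2 := by rw [← Finset.mul_sum, hsumn]
    have hT2 : ∑ x, ∑ y, a x y * m y / 2 ≤ d * N / 2 := by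
      calc ∑ x, ∑ y, a x y * m y / 2 = (∑ y, (∑ x, a x y) * m y) / 2 := by
            rw [Finset.sum_comm, Finset.sum_div]
            refine Finset.sum_congr rfl fun y _ => ?_
            rw [Finset.sum_mul, Finset.sum_div]
        _ ≤ (∑ y, (d : ℝ) * m y) / 2 := by
            gcongr with y _
            · exact hm0 y
            · exact hdeg2 y
        _ = d * N / 2 := by rw [← Finset.mul_sum, hsumn]
    calc |A.re| = |∑ x, ∑ y, ∑ σ : Fin 2, (if G.Adj x y then
            star (annihilation (orb x σ) *ᵥ ψ) ⬝ᵥ (annihilation (orb y σ) *ᵥ ψ) else (0 : ℂ)).re| := by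
          simp only [hA, Complex.re_sum]
      _ ≤ ∑ x, ∑ y, ∑ σ : Fin 2, |(if G.Adj x y then
            star (annihilation (orb x σ) *ᵥ ψ) ⬝ᵥ (annihilation (orb y σ) *ᵥ ψ) else (0 : ℂ)).re| := by
          refine (abs_sum_le_sum_abs _ _).trans (Finset.sum_le_sum fun x _ => ?_)
          exact (abs_sum_le_sum_abs _ _).trans (Finset.sum_le_sum fun y _ => abs_sum_le_sum_abs _ _)
      _ ≤ ∑ x, ∑ y, ∑ σ : Fin 2, a x y * ((n x σ + n y σ) / 2) :=
          Finset.sum_le_sum fun x _ => Finset.sum_le_sum fun y _ =>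
            Finset.sum_le_sum fun σ _ => hterm x y σ
      _ = ∑ x, ∑ y, a x y * m x / 2 + ∑ x, ∑ y, a x y * m y / 2 := by
          simp only [e1, Finset.sum_add_distrib]
      _ ≤ d * N / 2 + d * N / 2 := add_le_add hT1 hT2
      _ = d * N := by ring
  have h1 : -(|t| * d * N) ≤ (-(t : ℂ) * A).re := by
    have h2 : (-(t : ℂ) * A).re = -t * A.re := by simp [Complex.mul_re]
    rw [h2]
    have h3 : |t * A.re| ≤ |t| * (d * N) := by
      rw [abs_mul]
      exact mul_le_mul_of_nonneg_left hAre (abs_nonneg t)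
    have h4 := (abs_le.1 h3).2
    linarith
  -- the interaction part
  have h5 : 0 ≤ ((U : ℂ) * ∑ x, star ψ ⬝ᵥ (numberOp x 0 *ᵥ (numberOp x 1 *ᵥ ψ))).re := by
    rw [Complex.re_ofReal_mul, Complex.re_sum]
    exact mul_nonneg hU (Finset.sum_nonneg fun x _ => re_dotProduct_numberOp_numberOp_nonneg ψ x)
  linarith

end Degree

/-- **The Lieb–Wu ground-state roots for `N_a = N = 2`, `M = 1`.** At `m = 0` the Lieb–Wu
equations with the ground-state numbers `I = (-1/2, 1/2)`, `J = 0` force `k₀ = -k₁`, `Λ = 0`,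
`k₁ = π/2 - arctan(4s/U)` with `s = sin k₁ > 0`, `s²(U² + 16s²) = U²`, and Bethe energy
`-2(cos k₀ + cos k₁) = -16s²/U` (`= (U - √(U² + 64))/2`, the ground-state energy of the
DOUBLY-bonded two-site ring which these equations describe). Lieb–Wu, Physica A 321 (2003) 1,
§2 (the ring Hamiltonian with `N_a + 1 ≡ 1`) and §3. [cite: LiebWuPhysicaA2003, §§2–3] -/
theorem betheEnergy_of_isLiebWuGroundRoots_zero {U : ℝ} (hU : 0 < U) {k : Fin (4 * 0 + 2) → ℝ}
    {Λ : Fin (2 * 0 + 1) → ℝ} (h : IsLiebWuGroundRoots U 0 k Λ) :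
    ∃ s : ℝ, 0 < s ∧ s ^ 2 * (U ^ 2 + 16 * s ^ 2) = U ^ 2 ∧ betheEnergy k = -(16 * s ^ 2 / U) := by
  obtain ⟨⟨h1, h2⟩, hmono, -, hrange⟩ := h
  have hs1 : ∀ f : Fin (2 * 0 + 1) → ℝ, ∑ β, f β = f 0 := fun f => Fin.sum_univ_one f
  have hs2 : ∀ f : Fin (4 * 0 + 2) → ℝ, ∑ j, f j = f 0 + f 1 := fun f => Fin.sum_univ_two f
  have hI0 : liebWuGroundNumbers (4 * 0 + 2) 0 = -1 / 2 := by
    simp only [liebWuGroundNumbers]; norm_num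
  have hI1 : liebWuGroundNumbers (4 * 0 + 2) 1 = 1 / 2 := by
    simp only [liebWuGroundNumbers]; norm_num
  have hJ0 : liebWuGroundNumbers (2 * 0 + 1) 0 = 0 := by
    simp only [liebWuGroundNumbers]; norm_num
  have hNa : ((4 * 0 + 2 : ℕ) : ℝ) = 2 := by norm_num
  set θ₀ := liebWuTheta U (2 * Real.sin (k 0) - 2 * Λ 0) with hθ₀
  set θ₁ := liebWuTheta U (2 * Real.sin (k 1) - 2 * Λ 0) with hθ₁
  have e0 : (2 : ℝ) * k 0 = -π + θ₀ := by
    have := h1 0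
    rw [hs1, hI0, hNa] at this
    linarith
  have e1 : (2 : ℝ) * k 1 = π + θ₁ := by
    have := h1 1
    rw [hs1, hI1, hNa] at this
    linarith
  have f0 : θ₀ + θ₁ = 0 := by
    have := h2 0
    rw [hs2, hs1, hJ0, sub_self, liebWuTheta_zero] at this
    linarith
  -- `k 0 = -k 1`
  have hk : k 0 = -k 1 := by linarith
  -- `Λ 0 = 0`: `θ(2 s₁ - 2Λ) = -θ(-2 s₁ - 2Λ) = θ(2 s₁ + 2Λ)` and `θ` is injective
  have hθinj : Function.Injective (liebWuTheta U) := by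
    intro a b hab
    simp only [liebWuTheta] at hab
    have h3 : Real.arctan (2 * a / U) = Real.arctan (2 * b / U) := by linarith
    have h4 := Real.arctan_injective h3
    field_simp at h4
    linarith
  have hΛ : Λ 0 = 0 := by
    have h3 : θ₁ = liebWuTheta U (2 * Real.sin (k 1) + 2 * Λ 0) := by
      have : θ₀ = -liebWuTheta U (2 * Real.sin (k 1) + 2 * Λ 0) := by
        rw [hθ₀, hk, Real.sin_neg, ← liebWuTheta_neg]
        congr 1
        ring
      linarith
    have h4 := hθinj h3
    linarith
  -- `k 1 = π/2 - arctan (4 sin k₁ / U)`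
  set s := Real.sin (k 1) with hs
  have hk1 : k 1 = π / 2 - Real.arctan (4 * s / U) := by
    have : θ₁ = -2 * Real.arctan (4 * s / U) := by
      rw [hθ₁, hΛ, liebWuTheta]
      congr 2
      ring
    linarith
  have hspos : 0 < s := by
    rw [hs, hk1, Real.sin_pi_div_two_sub]
    exact Real.cos_arctan_pos _
  have hs' : s = 1 / Real.sqrt (1 + (4 * s / U) ^ 2) := by
    conv_lhs => rw [hs, hk1, Real.sin_pi_div_two_sub, Real.cos_arctan]
  have hcos : Real.cos (k 1) = 4 * s ^ 2 / U := by
    rw [hk1, Real.cos_pi_div_two_sub, Real.sin_arctan, div_eq_mul_one_div, ← hs']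
    ring
  have hD : 0 < 1 + (4 * s / U) ^ 2 := by positivity
  have h6 : s ^ 2 * (1 + (4 * s / U) ^ 2) = 1 := by
    have h7 : s ^ 2 = 1 / (1 + (4 * s / U) ^ 2) := by
      conv_lhs => rw [hs']
      rw [div_pow, one_pow, Real.sq_sqrt hD.le]
    rw [h7, one_div_mul_cancel hD.ne']
  refine ⟨s, hspos, ?_, ?_⟩
  · have hU0 : U ≠ 0 := hU.ne'
    field_simp at h6
    linear_combination h6
  · rw [betheEnergy, hs2, hk, Real.cos_neg, hcos]
    ring

/-- **The node F2 of `LiebWuBetheAnsatz`, quantified over ALL `m`, is false** (whence its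
replacement by F2′, `m ≥ 1`): at `U = 1`, `m = 0` it would give
`E₀(hubbardChain 2, N = 2) = -16 s²` with `s²(1 + 16 s²) = 1`, i.e. `E₀ = (1 - √65)/2 < -2`,
whereas `hubbardChain 2` has a single bond (every site has one neighbour), so
`E₀ ≥ -|t| · 1 · N = -2` (`neg_degree_mul_le_groundEnergyAt`). The Lieb–Wu equations with
`N_a = 2` describe the doubly-bonded ring `T Σ_{i=1}^{2} Σ_σ (c†_{iσ} c_{i+1,σ} + h.c.)`,
`c_{3σ} ≡ c_{1σ}`, of Lieb–Wu, Physica A 321 (2003) 1, §2, not `hubbardChain 2`; for `N_a ≥ 3`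
the two coincide. [cite: LiebWuPhysicaA2003, §2] -/
theorem not_liebWu_groundEnergyAt_eq_betheEnergy : ¬ liebWu_groundEnergyAt_eq_betheEnergy := by
  intro h
  obtain ⟨k, Λ, hk, hE⟩ := h 1 one_pos 0
  obtain ⟨s, hs, hrel, hb⟩ := betheEnergy_of_isLiebWuGroundRoots_zero one_pos hk
  have hdeg : ∀ x : FermionTorus 1 2, #{y | (hubbardChain 2).Adj x y} ≤ 1 := by
    intro x
    calc #{y | (hubbardChain 2).Adj x y} ≤ #(univ.erase x) :=
          card_le_card fun y hy => by
            rw [mem_filter] at hy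
            exact mem_erase.2 ⟨hy.2.ne.symm, mem_univ _⟩
      _ = 1 := by rw [card_erase_of_mem (mem_univ _), card_univ, card_fermionTorus_one]
  have hlow := neg_degree_mul_le_groundEnergyAt (hubbardChain 2) hdeg 1 zero_le_one (N := 2)
    (by rw [card_fermionTorus_one]; norm_num)
  change groundEnergyAt (hubbardChain 2) 1 1 2 = betheEnergy k at hE
  rw [hE, hb] at hlow
  norm_num at hlow hrel
  nlinarith [mul_nonneg (sq_nonneg s) (sq_nonneg s), sq_nonneg s]

end TwoSites

end Literature.MathematicalPhysics.QuantumLattice
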